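import Literature.NumberTheory.Automorphic.UnitaryGroupBorelModulusThree
import Literature.NumberTheory.Automorphic.UnitaryGroupHeisenbergFundamentalDomain
import Literature.NumberTheory.Automorphic.UnitaryGroupUnipotentUnimodularThree
import Literature.NumberTheory.Automorphic.UnitaryGroupKernelBorelTorusFibration
import Mathlib.MeasureTheory.Measure.Haar.Unique
import HarnessLib

/-!
# Conjugation by `B(𝔸_F)` scales the Haar measures of `N(𝔸_F)` by `δ_B`, and the Borel kernel of `U(3)`
# is `δ_B`-homogeneous: `K_B(b x, b y) = δ_B(b) K_B(x, y)`
(Rogawski, *Automorphic Representations of Unitary Groups in Three Variables* (1990), §1.10, §2.2: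
`δ_B(d(a, b, ā⁻¹)) = ‖a‖²_{𝔸_E}`, `K_P(x, y) = Σ_{γ ∈ M_P} ∫_{𝐍_P} f(x⁻¹ γ n y) dn`)

Topic `NumberTheory/Automorphic`; namespace `Literature.NumberTheory.Automorphic.UnitaryGroup`. THEOREMS
ONLY over accepted tree modules: no definition, no named fact, no `sorry`, no instance, no notation.
`N = 3` throughout (the Heisenberg chart ★ `heisHaar` and ★ `torusRootModulus_three_eq` are rank-one
letters); `c` is the non-trivial involution of `E/F` (`hc : c * c = 1`, `hc1 : c ≠ 1`).

* §1 **`map_torusConj_eq_torusRootModulus_smul`** — for EVERY Haar measure `ν` of the tree's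
  `N(𝔸_F) = adelicUnipotent F E c 3` and `t = diag(d) ∈ T(𝔸_F)`: the push-forward of `ν` under
  `u ↦ t⁻¹ u t` is `δ_B(t) • ν`, `δ_B(t) = torusRootModulus E 3 d = ‖d₀‖²_{𝔸_E}` (★ `heisHaar_map_conjBy`
  in the Heisenberg chart, transported along ★ `unipToBorelₜ` by uniqueness of Haar measure, and the
  arithmetic `‖d₀⁻¹d₁‖⁻¹ χ⁻(d₀⁻¹d₂)⁻¹ = ‖d₀‖²` of ★ `modularCharacter_borelAdelic_torus`).
* §2 **`map_borelConj_eq_torusRootModulus_smul`** — the same for every `b ∈ B(𝔸_F)` with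
  `δ_B(b) := torusRootModulus E 3 (diagUnit b)` (`b = t n₀`, `N(𝔸_F)` unimodular:
  ★ `isMulRightInvariant_of_isHaarMeasure_adelicUnipotent_three`); `integral_comp_borelConj`:
  `∫ φ(b⁻¹ u b) dν(u) = δ_B(b) ∫ φ dν`.
* §3 **`kernelBorel_borel_mul_mul`** — `K_B(b x, b y) = δ_B(b) · K_B(x, y)` for all `b ∈ B(𝔸_F)`,
  `x, y ∈ G(𝔸_F)`, `f ∈ C_c(G(𝔸_F))`, every Haar `ν` and fundamental domain `𝓕` of `N(F)`
  (★ `kernelBorel_eq_smul_tsum_integral`: `K_B(x, y) = ν(𝓕)⁻¹ Σ_{t ∈ T(F)} ∫_{N(𝔸_F)} f(x⁻¹ t m y) dν(m)`,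
  and `b⁻¹ t m b = t · [t, b] · (b⁻¹ m b)` with `[t, b] = t⁻¹ b⁻¹ t b ∈ N(𝔸_F)`). For `b ∈ B(F)` this is the
  `B(F)`-invariance ★ `kernelBorel_diag_rational_borel_mul` (`δ_B = 1` by the product formula); for
  `b ∈ T(𝔸_F)` it is the growth `K_B(g, g) ≍ H(g)²` of the Borel kernel in the cusp — the modulus
  input of the cell count `#R(g) ≤ C δ_B` (brick H4 of the T1-qs road to the integrability of `k^T`).

## References

* J. D. Rogawski, *Automorphic Representations of Unitary Groups in Three Variables*, Annals of
  Mathematics Studies 123 (1990), §1.10, §2.2 (p. 13) [Rogawski1990].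
* J. R. Getz, H. Hahn, *An Introduction to Automorphic Representations* (2024), §3.5 (3.10)
  [GetzHahn2024].
-/

noncomputable section

open MeasureTheory NumberField IsDedekindDomain Topology
open scoped NNReal ENNReal MatrixGroups

namespace Literature.NumberTheory.Automorphic

namespace UnitaryGroup

variable {F E : Type} [Field F] [NumberField F] [Field E] [NumberField E] [Algebra F E]
  {c : E ≃ₐ[F] E}

omit [NumberField F] [Algebra F E] in
/-- `𝔸_E` is Hausdorff (local copy of the standard three-line argument). [folklore] -/
private theorem t2Space_adeleRing_E₈ : T2Space (AdeleRing (𝓞 E) E) := by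
  haveI : T2Space (FiniteAdeleRing (𝓞 E) E) := inferInstanceAs <| T2Space
    (RestrictedProduct (fun w : HeightOneSpectrum (𝓞 E) => w.adicCompletion E)
      (fun w => (w.adicCompletionIntegers E : Set (w.adicCompletion E))) Filter.cofinite)
  haveI : T2Space (InfiniteAdeleRing E) :=
    inferInstanceAs <| T2Space ((w : InfinitePlace E) → w.Completion)
  exact inferInstanceAs <| T2Space (InfiniteAdeleRing E × FiniteAdeleRing (𝓞 E) E)

/-- `Δ(g⁻¹) = Δ(g)⁻¹` for the distributive Haar character (local copy). [folklore] -/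
private theorem distribHaarChar_inv'' {G A : Type*} [Group G] [AddCommGroup A] [DistribMulAction G A]
    [TopologicalSpace A] [IsTopologicalAddGroup A] [LocallyCompactSpace A] [ContinuousConstSMul G A]
    [MeasurableSpace A] [BorelSpace A] (g : G) :
    distribHaarChar A g⁻¹ = (distribHaarChar A g)⁻¹ :=
  eq_inv_of_mul_eq_one_left (by rw [← map_mul, inv_mul_cancel, map_one])

/-- The scalar of ★ `heisHaar_map_conjBy` is `δ_B`: `‖d₀⁻¹ d₁‖⁻¹ · χ⁻(d₀⁻¹ d₂)⁻¹ = torusRootModulus E 3 d`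
(the arithmetic of ★ `modularCharacter_borelAdelic_torus`: `χ⁻ = ‖·‖^{1/2}`, the torus relations
`‖d₁‖ = 1`, `‖d₂‖ = ‖d₀‖⁻¹`). [cite: Rogawski1990, §2.2] -/
private theorem conjScalar_eq_torusRootModulus [LocallyCompactSpace (AdeleRing (𝓞 E) E)]
    [MeasurableSpace (AdeleRing (𝓞 E) E)] [BorelSpace (AdeleRing (𝓞 E) E)]
    (hc : c * c = 1) (hc1 : c ≠ 1) (t : torusInBorel F E c 3) {d : Fin 3 → (AdeleRing (𝓞 E) E)ˣ}
    (hd : glDiagonal 3 (AdeleRing (𝓞 E) E) d =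
      adelicVal F E c 3 _ ((t : borelAdelic F E c 3) : (quasiSplit F E c 3).Adelic)) :
    (distribHaarChar (AdeleRing (𝓞 E) E) ((d 0)⁻¹ * d 1))⁻¹ *
        (traceZeroModulus ((d 0)⁻¹ * d 2) (conjAdele_torusCentralScalar t hd))⁻¹ =
      torusRootModulus E 3 d := by
  obtain ⟨δ, hδ⟩ := exists_conjAdele_eq_neg (F := F) (E := E) hc hc1
  obtain ⟨hχ1, hχ2⟩ := distribHaarChar_torus_three t hd
  rw [torusRootModulus_three_eq t hd, traceZeroModulus_eq_sqrt hc δ hδ ((d 0)⁻¹ * d 2)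
      (conjAdele_torusCentralScalar t hd), map_mul, map_mul, distribHaarChar_inv'', hχ1, hχ2, mul_one,
    inv_inv, ← mul_inv, NNReal.sqrt_inv, inv_inv, NNReal.sqrt_mul_self]

/-- `torusPart` is a homomorphism to the commutative `T(𝔸_F)`: `torusPart b⁻¹ = (torusPart b)⁻¹`.
[cite: Rogawski1990, §1.10] -/
theorem torusPart_inv {N : ℕ} (b : borelAdelic F E c N) : torusPart b⁻¹ = (torusPart b)⁻¹ := by
  have h1 : torusPart (1 : borelAdelic F E c N) = 1 := torusPart_eq_one_of_mem (Subgroup.one_mem _)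
  exact eq_inv_of_mul_eq_one_left (by rw [← torusPart_mul, inv_mul_cancel, h1])

/-- **The commutator `[t, b] = t⁻¹ b⁻¹ t b` of `t ∈ T(𝔸_F)` and `b ∈ B(𝔸_F)` lies in `N(𝔸_F)`**
(`T(𝔸_F)` is commutative, ★ `torusInBorel_comm`, and `N(𝔸_F)` is the kernel of ★ `torusPart`).
[cite: Rogawski1990, §1.10] -/
theorem torus_commutator_mem_adelicUnipotent {N : ℕ} {t : (quasiSplit F E c N).Adelic}
    (ht : t ∈ torusAdelic F E c N) (b : borelAdelic F E c N) :
    t⁻¹ * (b : (quasiSplit F E c N).Adelic)⁻¹ * t * b ∈ adelicUnipotent F E c N := by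
  set T : borelAdelic F E c N := ⟨t, torusAdelic_le_borelAdelic ht⟩ with hT
  have hTt : torusPart T = T := torusPart_eq_self_of_mem (b := T) ht
  -- `torusPart b` and `T` commute
  have hcomm : (torusPart b)⁻¹ * T = T * (torusPart b)⁻¹ := by
    have h := torusInBorel_comm (⟨(torusPart b)⁻¹, Subgroup.inv_mem _ (torusPart_mem_torusAdelic b)⟩ :
      torusInBorel F E c N) ⟨T, ht⟩
    exact congrArg Subtype.val h
  have hC : torusPart (T⁻¹ * b⁻¹ * T * b) = 1 := by
    rw [torusPart_mul, torusPart_mul, torusPart_mul, torusPart_inv, torusPart_inv, hTt, mul_assoc T⁻¹,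
      hcomm, ← mul_assoc, inv_mul_cancel, one_mul, inv_mul_cancel]
  exact (mem_unipotentInBorel_iff_torusPart_eq_one (T⁻¹ * b⁻¹ * T * b)).2 hC

/-! ## §1 Conjugation by the torus scales the Haar measures of `N(𝔸_F)` by `δ_B` -/

section Haar

variable [MeasurableSpace (adelicUnipotent F E c 3)] [BorelSpace (adelicUnipotent F E c 3)]

/-- **`(u ↦ t⁻¹ u t)_* ν = δ_B(t) • ν` for every Haar measure `ν` of `N(𝔸_F)`** (`N = 3`): for
`t = diag(d) ∈ T(𝔸_F)` the push-forward of `ν` under conjugation `u ↦ t⁻¹ u t` is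
`torusRootModulus E 3 d • ν = ‖d₀‖²_{𝔸_E} • ν`, i.e. `ν(t A t⁻¹) = δ_B(t) ν(A)`. Proof: in the Heisenberg
chart the Haar measure `dx dy` is scaled by `‖d₀⁻¹d₁‖⁻¹ χ⁻(d₀⁻¹d₂)⁻¹` (★ `heisHaar_map_conjBy`), which is
`δ_B(t)` (★ `torusRootModulus_three_eq`, the torus relations); every Haar measure is a multiple of the
transported `heisHaar` (Mathlib `isMulLeftInvariant_eq_smul`). (Rogawski (1990), §2.2:
`δ_B(d(a, b, ā⁻¹)) = ‖a‖²`; Getz–Hahn (2024), (3.10): `δ_P(m) = |det Ad(m)|_𝔫|`.) [cite: Rogawski1990, §2.2] -/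
theorem map_torusConj_eq_torusRootModulus_smul (hc : c * c = 1) (hc1 : c ≠ 1)
    (ν : Measure (adelicUnipotent F E c 3)) [ν.IsHaarMeasure] (t : torusInBorel F E c 3)
    {d : Fin 3 → (AdeleRing (𝓞 E) E)ˣ}
    (hd : glDiagonal 3 (AdeleRing (𝓞 E) E) d =
      adelicVal F E c 3 _ ((t : borelAdelic F E c 3) : (quasiSplit F E c 3).Adelic)) :
    ν.map (fun u : adelicUnipotent F E c 3 =>
      (⟨((t : borelAdelic F E c 3) : (quasiSplit F E c 3).Adelic)⁻¹ * (u : (quasiSplit F E c 3).Adelic) *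
          ((t : borelAdelic F E c 3) : (quasiSplit F E c 3).Adelic),
        conj_mem_adelicUnipotent (t : borelAdelic F E c 3).2 u.2⟩ : adelicUnipotent F E c 3)) =
      ((torusRootModulus E 3 d : ℝ≥0) : ℝ≥0∞) • ν := by
  haveI := locallyCompactSpace_adeleRing' E
  haveI := secondCountableTopology_adeleRing E
  haveI : T2Space (AdeleRing (𝓞 E) E) := t2Space_adeleRing_E₈
  letI : MeasurableSpace (AdeleRing (𝓞 E) E) := borel _
  haveI : BorelSpace (AdeleRing (𝓞 E) E) := ⟨rfl⟩
  letI : MeasurableSpace (borelAdelic F E c 3) := borel _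
  haveI : BorelSpace (borelAdelic F E c 3) := ⟨rfl⟩
  haveI := t2Space_borelAdelic (F := F) (E := E) (c := c) (N := 3)
  haveI := secondCountableTopology_borelAdelic (F := F) (E := E) (c := c) (N := 3)
  haveI := locallyCompactSpace_borelAdelic (F := F) (E := E) (c := c) (N := 3)
  haveI := locallyCompactSpace_traceZeroAdele (F := F) (E := E) (c := c)
  haveI : SecondCountableTopology (traceZeroAdele F E c) := TopologicalSpace.Subtype.secondCountableTopology _
  haveI : LocallyCompactSpace (unipotentInBorel F E c 3) :=
    (isTopSemidirect_borelAdelic (F := F) (E := E) (c := c) (N := 3)).isClosed_right.locallyCompactSpace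
  haveI : SecondCountableTopology (unipotentInBorel F E c 3) := TopologicalSpace.Subtype.secondCountableTopology _
  -- the Haar measure of `N(𝔸_F)` in Heisenberg coordinates
  set μX : Measure (AdeleRing (𝓞 E) E) := Measure.addHaar with hμX
  set μY : Measure (traceZeroAdele F E c) := Measure.addHaar with hμY
  haveI : μX.Regular := inferInstance
  haveI : μY.Regular := inferInstance
  haveI := isHaarMeasure_heisHaar hc μX μY
  -- transport `ν` along the tautological isomorphism `N(𝔸_F) ≃ₜ* unipotentInBorel`
  set e : adelicUnipotent F E c 3 ≃ₜ* unipotentInBorel F E c 3 := unipToBorelₜ F E c with he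
  have hme : Measurable e := e.continuous.measurable
  have hmes : Measurable e.symm := e.symm.continuous.measurable
  have hmc : Measurable (isTopSemidirect_borelAdelic.conjBy t :
      unipotentInBorel F E c 3 → unipotentInBorel F E c 3) := by
    refine Continuous.measurable (Continuous.subtype_mk ?_ _)
    exact (continuous_const.mul continuous_subtype_val).mul continuous_const
  set ν' : Measure (unipotentInBorel F E c 3) := ν.map e with hν'
  haveI : ν'.IsHaarMeasure := e.isHaarMeasure_map ν
  -- uniqueness of Haar measure and the scaling of `heisHaar`
  have hκ : ν' = Measure.haarScalarFactor ν' (heisHaar hc μX μY) • heisHaar hc μX μY :=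
    Measure.isMulLeftInvariant_eq_smul _ _
  have hθ := heisHaar_map_conjBy hc μX μY t hd
  have hconj' : ν'.map (isTopSemidirect_borelAdelic.conjBy t) =
      ((torusRootModulus E 3 d : ℝ≥0) : ℝ≥0∞) • ν' := by
    have h1 : ν'.map (isTopSemidirect_borelAdelic.conjBy t) =
        ((Measure.haarScalarFactor ν' (heisHaar hc μX μY) : ℝ≥0) : ℝ≥0∞) •
          ((((distribHaarChar (AdeleRing (𝓞 E) E) ((d 0)⁻¹ * d 1))⁻¹ *
              (traceZeroModulus ((d 0)⁻¹ * d 2) (conjAdele_torusCentralScalar t hd))⁻¹ : ℝ≥0) : ℝ≥0∞) •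
            heisHaar hc μX μY) := by
      conv_lhs => rw [hκ]
      rw [Measure.map_smul, hθ]
      rfl
    rw [h1, conjScalar_eq_torusRootModulus hc hc1 t hd, smul_smul, mul_comm, ← smul_smul]
    conv_rhs => rw [hκ]
    rfl
  -- the conjugation on `adelicUnipotent` is `e⁻¹ ∘ conjBy t ∘ e`
  have hcomp : (fun u : adelicUnipotent F E c 3 =>
      (⟨((t : borelAdelic F E c 3) : (quasiSplit F E c 3).Adelic)⁻¹ * (u : (quasiSplit F E c 3).Adelic) *
          ((t : borelAdelic F E c 3) : (quasiSplit F E c 3).Adelic),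
        conj_mem_adelicUnipotent (t : borelAdelic F E c 3).2 u.2⟩ : adelicUnipotent F E c 3)) =
      e.symm ∘ isTopSemidirect_borelAdelic.conjBy t ∘ e := by
    funext u
    rfl
  rw [hcomp, ← Measure.map_map hmes (hmc.comp hme), ← Measure.map_map hmc hme]
  change (ν'.map (isTopSemidirect_borelAdelic.conjBy t)).map e.symm = _
  rw [hconj', Measure.map_smul, hν', Measure.map_map hmes hme]
  have hid : (e.symm : unipotentInBorel F E c 3 → adelicUnipotent F E c 3) ∘ e = id :=
    funext fun u => e.symm_apply_apply u
  rw [hid, Measure.map_id]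

/-! ## §2 Conjugation by `B(𝔸_F)` and integrals over `N(𝔸_F)` -/

/-- **`(u ↦ b⁻¹ u b)_* ν = δ_B(b) • ν` for every `b ∈ B(𝔸_F)`** and every Haar measure `ν` of `N(𝔸_F)`
(`N = 3`), with `δ_B(b) = torusRootModulus E 3 (diagUnit b) = ‖b₀₀‖²_{𝔸_E}`: write `b = t n₀` with
`t = torusPart b`, `n₀ ∈ N(𝔸_F)`; conjugation by `n₀` preserves `ν` (`N(𝔸_F)` is unimodular,
★ `isMulRightInvariant_of_isHaarMeasure_adelicUnipotent_three`). [cite: Rogawski1990, §2.2] -/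
theorem map_borelConj_eq_torusRootModulus_smul (hc : c * c = 1) (hc1 : c ≠ 1)
    (ν : Measure (adelicUnipotent F E c 3)) [ν.IsHaarMeasure] (b : borelAdelic F E c 3) :
    ν.map (fun u : adelicUnipotent F E c 3 =>
      (⟨(b : (quasiSplit F E c 3).Adelic)⁻¹ * (u : (quasiSplit F E c 3).Adelic) * (b : (quasiSplit F E c 3).Adelic),
        conj_mem_adelicUnipotent b.2 u.2⟩ : adelicUnipotent F E c 3)) =
      ((torusRootModulus E 3 (diagUnit b.2) : ℝ≥0) : ℝ≥0∞) • ν := by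
  haveI := isMulRightInvariant_of_isHaarMeasure_adelicUnipotent_three hc ν
  -- `b = t n₀`
  set t : torusInBorel F E c 3 := ⟨torusPart b, (mem_torusInBorel_iff _).2 (torusPart_mem_torusAdelic b)⟩
    with ht
  have hd : glDiagonal 3 (AdeleRing (𝓞 E) E) (diagUnit b.2) =
      adelicVal F E c 3 _ ((t : borelAdelic F E c 3) : (quasiSplit F E c 3).Adelic) :=
    (adelicVal_torusPart b).symm
  set n₀ : adelicUnipotent F E c 3 :=
    ⟨(((torusPart b)⁻¹ * b : borelAdelic F E c 3) : (quasiSplit F E c 3).Adelic),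
      torusPart_inv_mul_mem_adelicUnipotent b⟩ with hn₀
  have hb : (b : (quasiSplit F E c 3).Adelic) =
      ((t : borelAdelic F E c 3) : (quasiSplit F E c 3).Adelic) * (n₀ : (quasiSplit F E c 3).Adelic) := by
    change (b : (quasiSplit F E c 3).Adelic) = ((torusPart b : borelAdelic F E c 3) : (quasiSplit F E c 3).Adelic) *
      (((torusPart b)⁻¹ * b : borelAdelic F E c 3) : (quasiSplit F E c 3).Adelic)
    rw [← Subgroup.coe_mul, mul_inv_cancel_left]
  have hmc : Measurable (fun u : adelicUnipotent F E c 3 =>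
      (⟨((t : borelAdelic F E c 3) : (quasiSplit F E c 3).Adelic)⁻¹ * (u : (quasiSplit F E c 3).Adelic) *
          ((t : borelAdelic F E c 3) : (quasiSplit F E c 3).Adelic),
        conj_mem_adelicUnipotent (t : borelAdelic F E c 3).2 u.2⟩ : adelicUnipotent F E c 3)) := by
    refine Continuous.measurable (Continuous.subtype_mk ?_ _)
    exact (continuous_const.mul continuous_subtype_val).mul continuous_const
  have hml : Measurable (fun u : adelicUnipotent F E c 3 => n₀⁻¹ * u) := (continuous_const.mul continuous_id).measurable
  have hmr : Measurable (fun u : adelicUnipotent F E c 3 => u * n₀) := (continuous_id.mul continuous_const).measurable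
  have hcomp : (fun u : adelicUnipotent F E c 3 =>
      (⟨(b : (quasiSplit F E c 3).Adelic)⁻¹ * (u : (quasiSplit F E c 3).Adelic) * (b : (quasiSplit F E c 3).Adelic),
        conj_mem_adelicUnipotent b.2 u.2⟩ : adelicUnipotent F E c 3)) =
      (fun u : adelicUnipotent F E c 3 => u * n₀) ∘ (fun u : adelicUnipotent F E c 3 => n₀⁻¹ * u) ∘
        (fun u : adelicUnipotent F E c 3 =>
          (⟨((t : borelAdelic F E c 3) : (quasiSplit F E c 3).Adelic)⁻¹ * (u : (quasiSplit F E c 3).Adelic) *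
              ((t : borelAdelic F E c 3) : (quasiSplit F E c 3).Adelic),
            conj_mem_adelicUnipotent (t : borelAdelic F E c 3).2 u.2⟩ : adelicUnipotent F E c 3)) := by
    funext u
    apply Subtype.ext
    change (b : (quasiSplit F E c 3).Adelic)⁻¹ * (u : (quasiSplit F E c 3).Adelic) * b =
      (n₀ : (quasiSplit F E c 3).Adelic)⁻¹ *
        (((t : borelAdelic F E c 3) : (quasiSplit F E c 3).Adelic)⁻¹ * (u : (quasiSplit F E c 3).Adelic) *
          ((t : borelAdelic F E c 3) : (quasiSplit F E c 3).Adelic)) * n₀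
    rw [hb]
    simp only [mul_inv_rev, mul_assoc]
  rw [hcomp, ← Measure.map_map hmr (hml.comp hmc), ← Measure.map_map hml hmc,
    map_torusConj_eq_torusRootModulus_smul hc hc1 ν t hd, Measure.map_smul, Measure.map_smul,
    map_mul_left_eq_self, map_mul_right_eq_self]

/-- **`∫_{N(𝔸_F)} φ(b⁻¹ u b) dν(u) = δ_B(b) · ∫_{N(𝔸_F)} φ dν`** for `b ∈ B(𝔸_F)`, every Haar measure `ν` of
`N(𝔸_F)` (`N = 3`) and every `φ` (change of variables along the measurable automorphism `u ↦ b⁻¹ u b`,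
★ `exists_continuousMulEquiv_adelicUnipotent_conj`). [cite: Rogawski1990, §2.2] -/
theorem integral_comp_borelConj (hc : c * c = 1) (hc1 : c ≠ 1)
    (ν : Measure (adelicUnipotent F E c 3)) [ν.IsHaarMeasure] (b : borelAdelic F E c 3)
    {V : Type*} [NormedAddCommGroup V] [NormedSpace ℝ V] (φ : adelicUnipotent F E c 3 → V) :
    ∫ u, φ ⟨(b : (quasiSplit F E c 3).Adelic)⁻¹ * (u : (quasiSplit F E c 3).Adelic) * (b : (quasiSplit F E c 3).Adelic),
        conj_mem_adelicUnipotent b.2 u.2⟩ ∂ν =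
      (torusRootModulus E 3 (diagUnit b.2) : ℝ) • ∫ u, φ u ∂ν := by
  obtain ⟨α, hα⟩ := exists_continuousMulEquiv_adelicUnipotent_conj (N := 3) b.2
  have hfun : (fun u : adelicUnipotent F E c 3 =>
      (⟨(b : (quasiSplit F E c 3).Adelic)⁻¹ * (u : (quasiSplit F E c 3).Adelic) * (b : (quasiSplit F E c 3).Adelic),
        conj_mem_adelicUnipotent b.2 u.2⟩ : adelicUnipotent F E c 3)) = α :=
    funext fun u => Subtype.ext (hα u).symm
  set ψ : adelicUnipotent F E c 3 ≃ᵐ adelicUnipotent F E c 3 := α.toHomeomorph.toMeasurableEquiv with hψ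
  have hψα : (ψ : adelicUnipotent F E c 3 → adelicUnipotent F E c 3) = α := rfl
  have hint : (fun u : adelicUnipotent F E c 3 =>
      φ ⟨(b : (quasiSplit F E c 3).Adelic)⁻¹ * (u : (quasiSplit F E c 3).Adelic) * (b : (quasiSplit F E c 3).Adelic),
        conj_mem_adelicUnipotent b.2 u.2⟩) = fun u => φ (ψ u) :=
    funext fun u => congrArg φ (congrFun hfun u)
  rw [hint, ← integral_map_equiv ψ φ, hψα, ← hfun, map_borelConj_eq_torusRootModulus_smul hc hc1 ν b]
  change ∫ v, φ v ∂((torusRootModulus E 3 (diagUnit b.2) : ℝ≥0) • ν) = _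
  rw [integral_smul_nnreal_measure, NNReal.smul_def]

/-! ## §3 The Borel kernel is `δ_B`-homogeneous: `K_B(b x, b y) = δ_B(b) K_B(x, y)` -/

/-- **`K_B(b x, b y) = δ_B(b) · K_B(x, y)`** for every `b ∈ B(𝔸_F)`, all `x, y ∈ U(J₃)(𝔸_F)`,
`f ∈ C_c(U(J₃)(𝔸_F))`, every Haar measure `ν` of `N(𝔸_F)` and every fundamental domain `𝓕` of `N(F)`:
by ★ `kernelBorel_eq_smul_tsum_integral`, `K_B(x, y) = ν(𝓕)⁻¹ Σ_{t ∈ T(F)} ∫ f(x⁻¹ t m y) dν(m)`, and for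
each `t`: `(bx)⁻¹ t m (by) = x⁻¹ · t [t, b] (b⁻¹ m b) · y` with `[t, b] ∈ N(𝔸_F)`
(`torus_commutator_mem_adelicUnipotent`), so the fibre integral picks up exactly `δ_B(b)` (§2 and left
invariance of `ν`). For `b ∈ B(F)` this is ★ `kernelBorel_diag_rational_borel_mul` (`δ_B(b) = 1`); along
`T(𝔸_F)` it is the growth `K_B(g, g) ≍ H(g)²` in the cusp (Rogawski (1990), §2.2). [cite: Rogawski1990, §2.2 (p. 13)] -/
theorem kernelBorel_borel_mul_mul (hc : c * c = 1) (hc1 : c ≠ 1)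
    (ν : Measure (adelicUnipotent F E c 3)) [ν.IsHaarMeasure] {𝓕 : Set (adelicUnipotent F E c 3)}
    (h𝓕 : IsFundamentalDomain (rationalUnipotent F E c 3) 𝓕 ν)
    {f : (quasiSplit F E c 3).Adelic → ℂ} (hfc : Continuous f) (hf : HasCompactSupport f)
    (b : borelAdelic F E c 3) (x y : (quasiSplit F E c 3).Adelic) :
    kernelBorel ν 𝓕 f ((b : (quasiSplit F E c 3).Adelic) * x) ((b : (quasiSplit F E c 3).Adelic) * y) =
      (torusRootModulus E 3 (diagUnit b.2) : ℝ) • kernelBorel ν 𝓕 f x y := by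
  rw [kernelBorel_eq_smul_tsum_integral ν h𝓕 hfc hf, kernelBorel_eq_smul_tsum_integral ν h𝓕 hfc hf,
    smul_comm, ← tsum_const_smul'' (torusRootModulus E 3 (diagUnit b.2) : ℝ)]
  congr 1
  refine tsum_congr fun t => ?_
  -- the commutator `[t, b] ∈ N(𝔸_F)`
  have hct := torus_commutator_mem_adelicUnipotent (t : torusAdelic F E c 3).2 b
  -- rewrite the integrand: `(bx)⁻¹ t m (by) = x⁻¹ t ([t,b] (b⁻¹ m b)) y`
  have hpt : ∀ m : adelicUnipotent F E c 3,
      f (((b : (quasiSplit F E c 3).Adelic) * x)⁻¹ * ((t : torusAdelic F E c 3) : (quasiSplit F E c 3).Adelic) *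
          ((m : adelicUnipotent F E c 3) : (quasiSplit F E c 3).Adelic) * ((b : (quasiSplit F E c 3).Adelic) * y)) =
        (fun u : adelicUnipotent F E c 3 =>
          f (x⁻¹ * ((t : torusAdelic F E c 3) : (quasiSplit F E c 3).Adelic) *
            (((⟨_, hct⟩ : adelicUnipotent F E c 3) * u : adelicUnipotent F E c 3) : (quasiSplit F E c 3).Adelic) * y))
          ⟨(b : (quasiSplit F E c 3).Adelic)⁻¹ * (m : (quasiSplit F E c 3).Adelic) * (b : (quasiSplit F E c 3).Adelic),
            conj_mem_adelicUnipotent b.2 m.2⟩ := by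
    intro m
    refine congrArg f ?_
    change ((b : (quasiSplit F E c 3).Adelic) * x)⁻¹ * ((t : torusAdelic F E c 3) : (quasiSplit F E c 3).Adelic) *
        ((m : adelicUnipotent F E c 3) : (quasiSplit F E c 3).Adelic) * ((b : (quasiSplit F E c 3).Adelic) * y) =
      x⁻¹ * ((t : torusAdelic F E c 3) : (quasiSplit F E c 3).Adelic) *
        ((((t : torusAdelic F E c 3) : (quasiSplit F E c 3).Adelic)⁻¹ * (b : (quasiSplit F E c 3).Adelic)⁻¹ *
            ((t : torusAdelic F E c 3) : (quasiSplit F E c 3).Adelic) * (b : (quasiSplit F E c 3).Adelic)) *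
          ((b : (quasiSplit F E c 3).Adelic)⁻¹ * (m : (quasiSplit F E c 3).Adelic) * (b : (quasiSplit F E c 3).Adelic))) * y
    simp only [mul_inv_rev, mul_assoc, mul_inv_cancel_left]
  simp_rw [hpt]
  rw [integral_comp_borelConj hc hc1 ν b (fun u : adelicUnipotent F E c 3 =>
      f (x⁻¹ * ((t : torusAdelic F E c 3) : (quasiSplit F E c 3).Adelic) *
        (((⟨_, hct⟩ : adelicUnipotent F E c 3) * u : adelicUnipotent F E c 3) : (quasiSplit F E c 3).Adelic) * y)),
    integral_mul_left_eq_self (fun u : adelicUnipotent F E c 3 =>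
      f (x⁻¹ * ((t : torusAdelic F E c 3) : (quasiSplit F E c 3).Adelic) *
        ((u : adelicUnipotent F E c 3) : (quasiSplit F E c 3).Adelic) * y)) (⟨_, hct⟩ : adelicUnipotent F E c 3)]

end Haar

end UnitaryGroup

end Literature.NumberTheory.Automorphic
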